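import Summits.Ventures.YMGap.Thresholds.PressureDerivativeSUN
import Summits.Ventures.YMGap.Thresholds.CouplingDerivativeClosed
import Summits.Ventures.YMGap.RobustBall.HaarSecondMoments
import Literature.MathematicalPhysics.QuantumFieldTheory.LatticeGaugePlaquetteLowerBound
import Literature.MathematicalPhysics.QuantumFieldTheory.StrongCouplingClustering
import Literature.Probability.LatticeModels.ProductMeasureTools
import HarnessLib

/-!
# The strong-coupling endpoint `β = 0`: the DLR state is the infinite Haar product; the Balian–Drouffe–Itzykson
# leading coefficients of the mean plaquette and of the free energy as kernel derivatives (row type C-PRESS, part 4)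

Cell `pub-ymgap`, seat ds-1 (gen 9). HONEST FRAMING: exact strong-coupling LATTICE statements at and near `β = 0` for `SU(N)`
Wilson lattice gauge theory on `ℤ^d` (rows `d = 4`); one-sided derivatives at the endpoint of the one-state window; nothing
about the continuum or the Clay problem. Kernel theorems only, 0 compute.
* **A (any compact `G`, `ρ`, `d`).** At `β = 0` the Wilson kernel is gluing with product Haar (`ymSpecification_zero_apply`),
  so `dg_∞ = zdHaar d G ∈ 𝒢(0)` (`zdHaar_mem_ymGibbsMeasures_zero`: the DLR equation is the resampling identity
  `map_glueWith_zdHaar_prod_pi`); in a uniqueness regime it is THE state (`eq_zdHaar_of_subsingleton`).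
* **B (`IsSpecialUnitaryModel ρ`, `N ≥ 2`).** Under `dg_∞`: `∫ W_p = 0`, `∫ W_p² = charVariance ρ / N²` (`1/4` for `SU(2)`,
  `1/(2N²)` for `N ≥ 3`), `∫ W_p W_q = 0` for `p ≠ q` (resample a link of `p` not in `q`: `exists_mem_plaquetteEdges_not_mem`,
  `integral_update_plaquette`); so `Cov(W_p, W_q) = δ_{pq} charVariance/N²` (`cov_zdPlaquetteObs_zdHaar`) and the response
  series at `β = 0` is `charVariance/N²` (`tsum_cov_zdPlaquetteObs_zdHaar`).
* **C (`d = 4`).** `SU(2)`: ★ `su2_eq_zdHaar_of_mem_zero`, `su2_cov_plaquette_zero` (`δ_{pq}/4`), `su2_responseSum_zero` (`1/4`),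
  `su2_plaquette_zero` (`u(0) = 0`); ★★ `su2_hasDerivWithinAt_plaquette_zero`: **`u'(0⁺) = 1/4`**, the right derivative at
  `β_W = 0` of `u(β_W) = ⟨½ Re tr U_p⟩` along any DLR selection — the BDI leading coefficient `u = β_W/4 + O(β_W²)` (the cell's
  STEP-0 number) as a kernel derivative; ★ `su2_hasDerivWithinAt_freeEnergyDensity_zero`: `f'(0⁺) = -12` (tree coupling);
  ★★ `su2_hasDerivWithinAt_energyWilson_zero`: the Wilson-normalised energy slope (`= g'`, part 2) has right derivative `3/2`
  at `0`, i.e. `g(β_W) = f(β_W/2) = -6β_W + (3/4)β_W² + o(β_W²)` — consistent with rb-p2's two-sided free-energy law;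
  every `SU(N)`, `N ≥ 3`: `eq_zdHaar_of_mem_zero_SU`, ★★ `hasDerivWithinAt_plaquette_zero_SU`: `u'(0⁺) = 1/(2N)`.
References: Balian–Drouffe–Itzykson, Phys. Rev. D 11 (1975) 2104; Osterwalder–Seiler, Ann. Phys. 110 (1978) 440, §3.
-/


noncomputable section

open MeasureTheory ProbabilityTheory Set Filter Topology
open scoped NNReal
open Literature.MathematicalPhysics.QuantumLattice (LGConfig ZdEdge ZdPlaquette fundamentalRep ymGibbsMeasures
  ymSpecification plaquetteObs plaquetteEdges freeEnergyDensity IsZdTranslationInvariant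
  infiniteVolumeLimitPoints_nonempty_holds mem_ymGibbsMeasuresTI_of_mem_infiniteVolumeLimitPoints
  continuous_fundamentalRep)
open Literature.MathematicalPhysics.QuantumFieldTheory hiding ZdEdge
open Summit.QuantumFields.YangMills.Theorems.FibreToTorus (energy_pressure_chord)
namespace Summit.Ventures.YMGap.PressureRegularity

/-! ## A. At `β = 0` the infinite Haar product is a DLR state (any compact `G`, any `ρ`, any `d`) -/

section HaarGibbs

open Literature.Probability.LatticeModels (glueWith IsGibbsMeasure)
open Literature.MathematicalPhysics.QuantumLattice (wilsonBoundaryAction measurable_glueWith_prod)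

variable {d N : ℕ} {G : Type*} [Group G] [TopologicalSpace G] [IsTopologicalGroup G] [CompactSpace G]
  [MeasurableSpace G] [BorelSpace G]

/-- At `β = 0` the Yang–Mills kernel in `Λ` with boundary condition `η` is the image of product Haar measure on `G^Λ`
under gluing with `η` (the tilt by `-0 · S_Λ` is trivial). [folklore] -/
theorem ymSpecification_zero_apply (ρ : G →* Matrix (Fin N) (Fin N) ℂ) (Λ : Finset (ZdEdge d)) (η : LGConfig d G) :
    ymSpecification (d := d) ρ 0 Λ η =
      (Measure.pi fun _ : ↥Λ => haarProbability G).map (glueWith Λ · η) := by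
  haveI : IsProbabilityMeasure ((Measure.pi fun _ : ↥Λ => haarProbability G).map (glueWith Λ · η)) :=
    Measure.isProbabilityMeasure_map
      (Literature.Probability.LatticeModels.measurable_glueWith Λ η).aemeasurable
  show ((Measure.pi fun _ : ↥Λ => haarProbability G).map (glueWith Λ · η)).tilted
      (fun U => -(0 : ℝ) * wilsonBoundaryAction ρ Λ U) = _
  have h0 : (fun U : LGConfig d G => -(0 : ℝ) * wilsonBoundaryAction ρ Λ U) = 0 := by
    funext U; simp
  rw [h0, tilted_zero]

/-- ★ **At `β = 0` the infinite product of Haar measures `dg_∞` is a DLR state of the Wilson specification**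
(`zdHaar d G ∈ 𝒢(0)`): the DLR equation in `Λ` is the resampling identity `map_glueWith_zdHaar_prod_pi` — replacing the
links in `Λ` of a `dg_∞`-sample by independent Haar samples gives a `dg_∞`-sample. [folklore] -/
theorem zdHaar_mem_ymGibbsMeasures_zero (ρ : G →* Matrix (Fin N) (Fin N) ℂ) :
    zdHaar d G ∈ ymGibbsMeasures (d := d) ρ 0 := by
  refine ⟨inferInstance, fun Λ A hA => ?_⟩
  have hmeasη : ∀ η : LGConfig d G, Measurable fun ζ : ↥Λ → G => glueWith Λ ζ η :=
    fun η => Literature.Probability.LatticeModels.measurable_glueWith Λ η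
  have h1 : ∀ η : LGConfig d G, ymSpecification (d := d) ρ 0 Λ η A =
      (Measure.pi fun _ : ↥Λ => haarProbability G) ((fun ζ : ↥Λ → G => glueWith Λ ζ η) ⁻¹' A) := fun η => by
    rw [ymSpecification_zero_apply, Measure.map_apply (hmeasη η) hA]
  simp_rw [h1]
  have hpre : MeasurableSet ((fun p : LGConfig d G × (↥Λ → G) => glueWith Λ p.2 p.1) ⁻¹' A) :=
    (measurable_glueWith_prod Λ) hA
  have h2 := Measure.prod_apply (μ := zdHaar d G) (ν := Measure.pi fun _ : ↥Λ => haarProbability G) hpre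
  have h3 : ((zdHaar d G).prod (Measure.pi fun _ : ↥Λ => haarProbability G))
      ((fun p : LGConfig d G × (↥Λ → G) => glueWith Λ p.2 p.1) ⁻¹' A) = zdHaar d G A := by
    rw [← Measure.map_apply (measurable_glueWith_prod Λ) hA, map_glueWith_zdHaar_prod_pi]
  rw [← h3, h2]
  exact lintegral_congr fun η => rfl

/-- In a uniqueness regime at `β = 0`, THE DLR state is the infinite Haar product. [folklore] -/
theorem eq_zdHaar_of_subsingleton (ρ : G →* Matrix (Fin N) (Fin N) ℂ)
    (hsub : (ymGibbsMeasures (d := d) ρ 0).Subsingleton) {μ : Measure (LGConfig d G)}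
    (hμ : μ ∈ ymGibbsMeasures (d := d) ρ 0) : μ = zdHaar d G :=
  hsub hμ (zdHaar_mem_ymGibbsMeasures_zero ρ)

end HaarGibbs

/-! ## B. Plaquette moments under the infinite Haar product (`G = SU(N)`, `N ≥ 2`) -/

section HaarMoments

open Literature.MathematicalPhysics.QuantumFieldTheory.PlaquetteLowerBound (reTr charVariance integral_reTr_eq_zero
  integral_comp_plaquette_eq)
open Literature.MathematicalPhysics.QuantumFieldTheory.AreaLaw (continuous_plaquette integrable_zdHaar_of_continuous)
open Literature.MathematicalPhysics.QuantumLattice (isCylinder_plaquetteObs)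

variable {d N : ℕ} {G : Type*} [Group G] [TopologicalSpace G] [IsTopologicalGroup G] [CompactSpace G]
  [MeasurableSpace G] [BorelSpace G] [SecondCountableTopology G]

/-- **Haar mean zero of every plaquette**: `∫ W_p dg_∞ = 0` for `G = SU(N)`, `N ≥ 2` (the plaquette variable is Haar
distributed, `integral_comp_plaquette_eq`, and `∫ Re tr ρ dg = 0`, `integral_reTr_eq_zero`). [folklore] -/
theorem integral_zdPlaquetteObs_zdHaar {ρ : G →* Matrix (Fin N) (Fin N) ℂ} (hρ : IsSpecialUnitaryModel ρ) (hN : 2 ≤ N)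
    (p : ZdPlaquette d) :
    ∫ U, zdPlaquetteObs ρ p.1 p.2.1.1 p.2.1.2 U ∂(zdHaar d G) = 0 := by
  have hΦ : Continuous fun g : G => (N : ℝ)⁻¹ * reTr ρ g :=
    continuous_const.mul (PlaquetteLowerBound.continuous_reTr ρ hρ.1)
  have h := integral_comp_plaquette_eq (d := d) hΦ p.1 (ne_of_lt p.2.2)
  have hW : ∀ U : ZdGaugeConfig d G, zdPlaquetteObs ρ p.1 p.2.1.1 p.2.1.2 U =
      (N : ℝ)⁻¹ * reTr ρ (ZdGaugeConfig.plaquette U p.1 p.2.1.1 p.2.1.2) := fun U => rfl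
  simp_rw [hW]
  rw [h, integral_const_mul, integral_reTr_eq_zero ρ hρ hN, mul_zero]

/-- **Haar second moment of a plaquette**: `∫ W_p² dg_∞ = charVariance ρ / N²` (`= 1/4` for `SU(2)`, `1/(2N²)` for
`N ≥ 3`). [folklore] -/
theorem integral_zdPlaquetteObs_sq_zdHaar {ρ : G →* Matrix (Fin N) (Fin N) ℂ} (hρc : Continuous ρ)
    (p : ZdPlaquette d) :
    ∫ U, zdPlaquetteObs ρ p.1 p.2.1.1 p.2.1.2 U ^ 2 ∂(zdHaar d G) = charVariance ρ / (N : ℝ) ^ 2 := by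
  have hΦ : Continuous fun g : G => ((N : ℝ)⁻¹ * reTr ρ g) ^ 2 :=
    (continuous_const.mul (PlaquetteLowerBound.continuous_reTr ρ hρc)).pow 2
  have h := integral_comp_plaquette_eq (d := d) hΦ p.1 (ne_of_lt p.2.2)
  have hW : ∀ U : ZdGaugeConfig d G, zdPlaquetteObs ρ p.1 p.2.1.1 p.2.1.2 U ^ 2 =
      ((N : ℝ)⁻¹ * reTr ρ (ZdGaugeConfig.plaquette U p.1 p.2.1.1 p.2.1.2)) ^ 2 := fun U => rfl
  simp_rw [hW]
  rw [h]
  simp_rw [mul_pow]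
  rw [integral_const_mul, charVariance]
  field_simp

/-- Two distinct plaquettes: some link of the first is not a link of the second. [folklore] -/
theorem exists_mem_plaquetteEdges_not_mem {p q : ZdPlaquette d} (hpq : p ≠ q) :
    ∃ e ∈ plaquetteEdges p, e ∉ plaquetteEdges q := by
  by_contra h
  push Not at h
  -- all four links of `p` are links of `q`; the two links based at `p.1` force `q = p`
  obtain ⟨x, ⟨i, j⟩, hij⟩ := p
  obtain ⟨y, ⟨k, l⟩, hkl⟩ := q
  have h1 : ((x, i) : ZdEdge d) ∈ plaquetteEdges ((y, ⟨(k, l), hkl⟩) : ZdPlaquette d) :=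
    h _ (by simp [plaquetteEdges])
  have h2 : ((x, j) : ZdEdge d) ∈ plaquetteEdges ((y, ⟨(k, l), hkl⟩) : ZdPlaquette d) :=
    h _ (by simp [plaquetteEdges])
  rw [mk_mem_plaquetteEdges_iff] at h1 h2
  simp only at h1 h2 hij hkl
  have hsingle : ∀ {m m' : Fin d},
      y + (Pi.single m (1 : ℤ) : Literature.Probability.LatticeModels.Site d) = y + Pi.single m' 1 → m = m' :=
    fun hm => single_index_injective (add_left_cancel hm)
  apply hpq
  rcases h1 with ⟨hki, hx1⟩ | ⟨hli, hx1⟩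
  · rcases h2 with ⟨hkj, hx2⟩ | ⟨hlj, hx2⟩
    · exact absurd (hki.symm.trans hkj) (ne_of_lt hij)
    · -- `k = i`, `l = j`: the base points agree
      have hxy : x = y := by
        rcases hx1 with h1' | h1'
        · exact h1'
        · rcases hx2 with h2' | h2'
          · exact absurd (hsingle (h1'.symm.trans h2')) (ne_of_lt hkl).symm
          · exact h2'
      subst hxy; subst hki; subst hlj; rfl
  · rcases h2 with ⟨hkj, hx2⟩ | ⟨hlj, hx2⟩
    · -- `l = i`, `k = j`: then `l < k < l`
      have hlk : l < k := by rw [hli, hkj]; exact hij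
      exact absurd (lt_trans hlk hkl) (lt_irrefl _)
    · exact absurd (hli.symm.trans hlj) (ne_of_lt hij)

/-- **Distinct plaquettes are uncorrelated under the infinite Haar product**: `∫ W_p W_q dg_∞ = 0` for `p ≠ q`
(`G = SU(N)`, `N ≥ 2`): resample a link of `p` that is not a link of `q` (`integral_infinitePi_eq_integral_update`);
`W_q` is unchanged and the Haar average of `W_p` over that link vanishes (`integral_update_plaquette`,
`integral_reTr_eq_zero`). [folklore] -/
theorem integral_zdPlaquetteObs_mul_zdHaar {ρ : G →* Matrix (Fin N) (Fin N) ℂ} (hρ : IsSpecialUnitaryModel ρ)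
    (hN : 2 ≤ N) {p q : ZdPlaquette d} (hpq : p ≠ q) :
    ∫ U, zdPlaquetteObs ρ p.1 p.2.1.1 p.2.1.2 U * zdPlaquetteObs ρ q.1 q.2.1.1 q.2.1.2 U ∂(zdHaar d G) = 0 := by
  classical
  obtain ⟨e, hep, heq⟩ := exists_mem_plaquetteEdges_not_mem hpq
  have hcontW : ∀ r : ZdPlaquette d, Continuous (zdPlaquetteObs (d := d) ρ r.1 r.2.1.1 r.2.1.2) := fun r =>
    continuous_const.mul ((PlaquetteLowerBound.continuous_reTr ρ hρ.1).comp
      (continuous_plaquette r.1 r.2.1.1 r.2.1.2))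
  have hint : Integrable (fun U => zdPlaquetteObs ρ p.1 p.2.1.1 p.2.1.2 U * zdPlaquetteObs ρ q.1 q.2.1.1 q.2.1.2 U)
      (zdHaar d G) := integrable_zdHaar_of_continuous ((hcontW p).mul (hcontW q))
  rw [zdHaar, Literature.Probability.LatticeModels.integral_infinitePi_eq_integral_update
    (fun _ : ZdEdge d => haarProbability G) e hint]
  -- `W_q` does not depend on the link `e`
  have hq : ∀ (U : ZdGaugeConfig d G) (g : G), zdPlaquetteObs ρ q.1 q.2.1.1 q.2.1.2 (Function.update U e g) =
      zdPlaquetteObs ρ q.1 q.2.1.1 q.2.1.2 U := fun U g => by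
    have h := isCylinder_plaquetteObs (G := G) ρ q (fun e' (he' : e' ∈ (↑(plaquetteEdges q) : Set (ZdEdge d))) =>
      show Function.update U e g e' = U e' by
        rw [Function.update_of_ne]; rintro rfl; exact heq he')
    show (N : ℝ)⁻¹ * plaquetteObs ρ q.1 q.2.1.1 q.2.1.2 (Function.update U e g) =
      (N : ℝ)⁻¹ * plaquetteObs ρ q.1 q.2.1.1 q.2.1.2 U
    rw [h]
  -- the Haar average of `W_p` over the link `e` vanishes
  have he4 : e = (p.1, p.2.1.1) ∨ e = (p.1 + Pi.single p.2.1.1 1, p.2.1.2) ∨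
      e = (p.1 + Pi.single p.2.1.2 1, p.2.1.1) ∨ e = (p.1, p.2.1.2) := by
    simpa [plaquetteEdges] using hep
  have hp : ∀ U : ZdGaugeConfig d G,
      ∫ g, zdPlaquetteObs ρ p.1 p.2.1.1 p.2.1.2 (Function.update U e g) ∂haarProbability G = 0 := fun U => by
    have hΦ : Continuous fun g : G => (N : ℝ)⁻¹ * reTr ρ g :=
      continuous_const.mul (PlaquetteLowerBound.continuous_reTr ρ hρ.1)
    have h := (integral_update_plaquette (d := d) hΦ p.1 (ne_of_lt p.2.2) U he4).2
    have hW : ∀ V : ZdGaugeConfig d G, zdPlaquetteObs ρ p.1 p.2.1.1 p.2.1.2 V =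
        (N : ℝ)⁻¹ * reTr ρ (ZdGaugeConfig.plaquette V p.1 p.2.1.1 p.2.1.2) := fun V => rfl
    simp_rw [hW]
    rw [h, integral_const_mul, integral_reTr_eq_zero ρ hρ hN, mul_zero]
  simp_rw [hq]
  have hinner : ∀ U : ZdGaugeConfig d G,
      ∫ g, zdPlaquetteObs ρ p.1 p.2.1.1 p.2.1.2 (Function.update U e g) * zdPlaquetteObs ρ q.1 q.2.1.1 q.2.1.2 U
        ∂haarProbability G = 0 := fun U => by
    rw [integral_mul_const, hp U, zero_mul]
  simp_rw [hinner]
  simp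

/-- ★ **Plaquette covariances under the infinite Haar product**: `Cov_{dg_∞}(W_p, W_q) = δ_{pq} · charVariance ρ / N²`
(`G = SU(N)`, `N ≥ 2`). [folklore] -/
theorem cov_zdPlaquetteObs_zdHaar {ρ : G →* Matrix (Fin N) (Fin N) ℂ} (hρ : IsSpecialUnitaryModel ρ) (hN : 2 ≤ N)
    (p q : ZdPlaquette d) :
    cov[zdPlaquetteObs ρ p.1 p.2.1.1 p.2.1.2, zdPlaquetteObs ρ q.1 q.2.1.1 q.2.1.2; zdHaar d G] =
      if p = q then charVariance ρ / (N : ℝ) ^ 2 else 0 := by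
  classical
  have hmeas : ∀ r : ZdPlaquette d, Measurable (zdPlaquetteObs (d := d) ρ r.1 r.2.1.1 r.2.1.2) := fun r =>
    (continuous_const.mul ((PlaquetteLowerBound.continuous_reTr ρ hρ.1).comp
      (continuous_plaquette r.1 r.2.1.1 r.2.1.2))).measurable
  have hbd : ∀ (r : ZdPlaquette d) (U : ZdGaugeConfig d G), |zdPlaquetteObs (d := d) ρ r.1 r.2.1.1 r.2.1.2 U| ≤ 1 :=
    fun r U => abs_zdPlaquetteObs_le (IsSpecialUnitaryModel.mem_unitaryGroup ρ hρ) _ _ _ U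
  rw [CouplingResponse.covariance_eq_sub_of_abs_le (hmeas p) (hmeas q) (hbd p) (hbd q),
    integral_zdPlaquetteObs_zdHaar hρ hN p, integral_zdPlaquetteObs_zdHaar hρ hN q, zero_mul, sub_zero]
  split_ifs with h
  · subst h
    simp_rw [← pow_two]
    exact integral_zdPlaquetteObs_sq_zdHaar hρ.1 p
  · exact integral_zdPlaquetteObs_mul_zdHaar hρ hN h

/-- ★ **The response series at `β = 0`**: `Σ_q Cov_{dg_∞}(W_p, W_q) = charVariance ρ / N²`. [folklore] -/
theorem tsum_cov_zdPlaquetteObs_zdHaar {ρ : G →* Matrix (Fin N) (Fin N) ℂ} (hρ : IsSpecialUnitaryModel ρ)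
    (hN : 2 ≤ N) (p : ZdPlaquette d) :
    ∑' q : ZdPlaquette d, cov[zdPlaquetteObs ρ p.1 p.2.1.1 p.2.1.2, zdPlaquetteObs ρ q.1 q.2.1.1 q.2.1.2;
      zdHaar d G] = charVariance ρ / (N : ℝ) ^ 2 := by
  classical
  rw [tsum_eq_single p fun q hq => by rw [cov_zdPlaquetteObs_zdHaar hρ hN, if_neg (Ne.symm hq)]]
  rw [cov_zdPlaquetteObs_zdHaar hρ hN, if_pos rfl]

end HaarMoments

end Summit.Ventures.YMGap.PressureRegularity

namespace Summit.Ventures.YMGap.PressureRegularity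

/-! ## C. `SU(N)` at `β = 0`: the Balian–Drouffe–Itzykson leading coefficients as kernel derivatives -/

section ZeroCoupling

open Literature.MathematicalPhysics.QuantumFieldTheory.PlaquetteLowerBound (charVariance)
open Literature.MathematicalPhysics.QuantumFieldTheory.TorusAreaLaw (isSpecialUnitaryModel_fundamentalRep)
open Summit.Ventures.YMGap.RobustBall.HaarSecondMoments (charVariance_su2 charVariance_suN)
open Summit.Ventures.YMGap.CouplingResponse (su2_hasDerivWithinAt_integral_9_25 hasDerivWithinAt_integral_SU_thooft)

/-- Local shorthand: the planes `{(i, j) : i < j}` of `ℤ⁴`. -/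
local notation3 (prettyPrint := false) "𝔓₄" => {q : Fin 4 × Fin 4 // q.1 < q.2}

/-- `SU(N)` is second countable (closed subgroup of `N × N` complex matrices). [folklore] -/
private theorem secondCountable_suN' {N : ℕ} : SecondCountableTopology (Matrix.specialUnitaryGroup (Fin N) ℂ) :=
  haveI : SecondCountableTopology (Matrix (Fin N) (Fin N) ℂ) :=
    inferInstanceAs (SecondCountableTopology (Fin N → Fin N → ℂ))
  Topology.IsEmbedding.subtypeVal.secondCountableTopology

/-- ★ **`SU(2)`, `d = 4`, `β = 0`: THE DLR state is the infinite Haar product** (uniqueness on `[0, 9/50]` and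
`zdHaar_mem_ymGibbsMeasures_zero`). -/
theorem su2_eq_zdHaar_of_mem_zero {ν : Measure (LGConfig 4 (Matrix.specialUnitaryGroup (Fin 2) ℂ))}
    (hν : ν ∈ ymGibbsMeasures (d := 4) (fundamentalRep (Fin 2)) 0) :
    ν = zdHaar 4 (Matrix.specialUnitaryGroup (Fin 2) ℂ) :=
  eq_zdHaar_of_subsingleton _ (su2_subsingleton_ymGibbsMeasures ⟨le_rfl, by norm_num⟩) hν

/-- ★ **Plaquette covariances of the `SU(2)` DLR state at `β = 0`**: `Cov_ν(W_p, W_q) = δ_{pq}/4` for every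
`ν ∈ 𝒢(0)` (`W = ½ Re tr`; `charVariance = 1` for `SU(2)`). -/
theorem su2_cov_plaquette_zero {ν : Measure (LGConfig 4 (Matrix.specialUnitaryGroup (Fin 2) ℂ))}
    (hν : ν ∈ ymGibbsMeasures (d := 4) (fundamentalRep (Fin 2)) 0) (p q : ZdPlaquette 4) :
    cov[zdPlaquetteObs (fundamentalRep (Fin 2)) p.1 p.2.1.1 p.2.1.2,
        zdPlaquetteObs (fundamentalRep (Fin 2)) q.1 q.2.1.1 q.2.1.2; ν] = if p = q then (1 / 4 : ℝ) else 0 := by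
  haveI := secondCountable_suN' (N := 2)
  rw [su2_eq_zdHaar_of_mem_zero hν, cov_zdPlaquetteObs_zdHaar (isSpecialUnitaryModel_fundamentalRep 2) le_rfl,
    charVariance_su2]
  norm_num

/-- ★ **The response series of `SU(2)` at `β = 0` is `1/4`**: `Σ_q Cov_ν(W_p, W_q) = Var_{Haar}(W_p) = 1/4`. -/
theorem su2_responseSum_zero {ν : Measure (LGConfig 4 (Matrix.specialUnitaryGroup (Fin 2) ℂ))}
    (hν : ν ∈ ymGibbsMeasures (d := 4) (fundamentalRep (Fin 2)) 0) (p : ZdPlaquette 4) :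
    ∑' q : ZdPlaquette 4, cov[zdPlaquetteObs (fundamentalRep (Fin 2)) p.1 p.2.1.1 p.2.1.2,
      zdPlaquetteObs (fundamentalRep (Fin 2)) q.1 q.2.1.1 q.2.1.2; ν] = 1 / 4 := by
  haveI := secondCountable_suN' (N := 2)
  rw [su2_eq_zdHaar_of_mem_zero hν, tsum_cov_zdPlaquetteObs_zdHaar (isSpecialUnitaryModel_fundamentalRep 2) le_rfl,
    charVariance_su2]
  norm_num

/-- **The mean plaquette of `SU(2)` vanishes at `β = 0`**: `u(0) = ⟨W_p⟩_ν = 0` for every `ν ∈ 𝒢(0)`. -/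
theorem su2_plaquette_zero {ν : Measure (LGConfig 4 (Matrix.specialUnitaryGroup (Fin 2) ℂ))}
    (hν : ν ∈ ymGibbsMeasures (d := 4) (fundamentalRep (Fin 2)) 0) (p : ZdPlaquette 4) :
    ∫ U, zdPlaquetteObs (fundamentalRep (Fin 2)) p.1 p.2.1.1 p.2.1.2 U ∂ν = 0 := by
  haveI := secondCountable_suN' (N := 2)
  rw [su2_eq_zdHaar_of_mem_zero hν]
  exact integral_zdPlaquetteObs_zdHaar (isSpecialUnitaryModel_fundamentalRep 2) le_rfl p

/-- ★★ **`u'(0⁺) = 1/4` — the Balian–Drouffe–Itzykson leading coefficient of the `SU(2)` mean plaquette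
`u(β_W) = β_W/4 + O(β_W²)` AS A KERNEL DERIVATIVE**: along ANY DLR selection `β_W ↦ μ β_W ∈ 𝒢(2(β_W/4))` on `[0, 9/25]`,
the mean plaquette `β_W ↦ ⟨W_p⟩_{μ β_W}` (which vanishes at `β_W = 0`, `su2_plaquette_zero`) has RIGHT DERIVATIVE `1/4` at
`β_W = 0` (within `[0, 9/25]`): g8's closed-window fluctuation–response formula at `0⁺` evaluated on the Haar product. -/
theorem su2_hasDerivWithinAt_plaquette_zero
    {μ : ℝ → Measure (LGConfig 4 (Matrix.specialUnitaryGroup (Fin 2) ℂ))}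
    (hμ : ∀ βW ∈ Icc (0 : ℝ) (9 / 25), μ βW ∈ ymGibbsMeasures (d := 4) (fundamentalRep (Fin 2)) (2 * (βW / 4)))
    (p : ZdPlaquette 4) :
    HasDerivWithinAt (fun t => ∫ U, zdPlaquetteObs (fundamentalRep (Fin 2)) p.1 p.2.1.1 p.2.1.2 U ∂(μ t))
      (1 / 4 : ℝ) (Icc (0 : ℝ) (9 / 25)) 0 := by
  have h0 : μ 0 ∈ ymGibbsMeasures (d := 4) (fundamentalRep (Fin 2)) 0 := by
    simpa using hμ 0 ⟨le_rfl, by norm_num⟩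
  have h := su2_hasDerivWithinAt_integral_9_25 hμ (isLipschitzCylinder_zdPlaquetteObs (N := 2) p.1 p.2.2)
    (x₀ := p.1) (D := 1) (fun e he => by simpa using norm_fst_sub_le_of_mem_plaquetteEdges he)
    (βW := 0) ⟨le_rfl, by norm_num⟩
  rwa [su2_responseSum_zero h0 p] at h

/-- ★ **`f'(0⁺) = -12` for `SU(2)`, `d = 4`** (tree coupling; `= -N · #planes`): the right derivative of the free energy
density at `β = 0` within `[0, 9/50]` — every plaquette has Haar mean zero. -/
theorem su2_hasDerivWithinAt_freeEnergyDensity_zero :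
    HasDerivWithinAt (freeEnergyDensity 4 (fundamentalRep (Fin 2))) (-12 : ℝ) (Icc (0 : ℝ) (9 / 50)) 0 := by
  classical
  obtain ⟨μ, hμ⟩ := CouplingResponse.exists_dlrSelection
  have hμsel : ∀ t ∈ Icc (0 : ℝ) (9 / 50), μ (2 * t) ∈ ymGibbsMeasures (d := 4) (fundamentalRep (Fin 2)) t := by
    intro t _
    have h := hμ (2 * t)
    rwa [show (2 : ℝ) * (2 * t / 4) = t by ring] at h
  have h := su2_hasDerivWithinAt_freeEnergyDensity hμsel (β := 0) ⟨le_rfl, by norm_num⟩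
  have h0 : μ (2 * 0) ∈ ymGibbsMeasures (d := 4) (fundamentalRep (Fin 2)) 0 := hμsel 0 ⟨le_rfl, by norm_num⟩
  have hplaq : ∀ q : 𝔓₄, ∫ U, plaquetteObs (fundamentalRep (Fin 2)) 0 q.1.1 q.1.2 U ∂(μ (2 * 0)) = 0 := fun q => by
    rw [integral_plaquetteObs_eq_mul ((0 : Literature.Probability.LatticeModels.Site 4), q) (μ (2 * 0)),
      su2_plaquette_zero h0 ((0 : Literature.Probability.LatticeModels.Site 4), q), mul_zero]
  simp only [hplaq, sub_zero, Finset.sum_const, Finset.card_univ, nsmul_eq_mul] at h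
  have hcard : (Fintype.card 𝔓₄ : ℝ) = 6 := by
    rw [Fintype.card_subtype]; norm_cast
  rw [hcard] at h
  norm_num at h
  exact h

/-- ★★ **`g''(0⁺) = 3/2` in Wilson's normalisation — the quadratic Balian–Drouffe–Itzykson coefficient of the `SU(2)` free
energy `g(β_W) = f(β_W/2) = -6 β_W + (3/4) β_W² + o(β_W²)` AS A KERNEL DERIVATIVE**: along any DLR selection on `[0, 9/25]`,
the Wilson-normalised energy slope `β_W ↦ -Σ_{i<j} (1 - ⟨W_{p_ij}⟩_{μ β_W})` (which is `g'` on the open window,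
`su2_hasDerivAt_freeEnergyDensity_wilson`, and equals `-6` at `β_W = 0`) has right derivative `6 · (1/4) = 3/2` at `β_W = 0`.
Consistent with rb-p2's two-sided free-energy law (leading term `(3/4) β_W²`). -/
theorem su2_hasDerivWithinAt_energyWilson_zero
    {μ : ℝ → Measure (LGConfig 4 (Matrix.specialUnitaryGroup (Fin 2) ℂ))}
    (hμ : ∀ βW ∈ Icc (0 : ℝ) (9 / 25), μ βW ∈ ymGibbsMeasures (d := 4) (fundamentalRep (Fin 2)) (2 * (βW / 4))) :
    HasDerivWithinAt (fun t => -∑ q : 𝔓₄, ((1 : ℝ) -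
        ∫ U, zdPlaquetteObs (fundamentalRep (Fin 2)) 0 q.1.1 q.1.2 U ∂(μ t))) (3 / 2 : ℝ) (Icc (0 : ℝ) (9 / 25)) 0 := by
  have h := HasDerivWithinAt.fun_sum (u := (Finset.univ : Finset 𝔓₄)) fun q _ =>
    ((hasDerivWithinAt_const (0 : ℝ) (Icc (0 : ℝ) (9 / 25)) (1 : ℝ)).sub
      (su2_hasDerivWithinAt_plaquette_zero hμ ((0 : Literature.Probability.LatticeModels.Site 4), q)))
  refine h.fun_neg.congr_deriv ?_
  have hcard : (Fintype.card 𝔓₄ : ℝ) = 6 := by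
    rw [Fintype.card_subtype]; norm_cast
  rw [Finset.sum_const, Finset.card_univ, nsmul_eq_mul, hcard]
  norm_num

/-- `SU(N)`, `N ≥ 2`, `d = 4`, `b = 0`: THE DLR state is the infinite Haar product (uniqueness on the closed 't Hooft
window, part 3). -/
theorem eq_zdHaar_of_mem_zero_SU {N : ℕ} (hN : 2 ≤ N) {ν : Measure (LGConfig 4 (Matrix.specialUnitaryGroup (Fin N) ℂ))}
    (hν : ν ∈ ymGibbsMeasures (d := 4) (fundamentalRep (Fin N)) 0) :
    ν = zdHaar 4 (Matrix.specialUnitaryGroup (Fin N) ℂ) :=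
  eq_zdHaar_of_subsingleton _ (subsingleton_ymGibbsMeasures_SU_thooft hN ⟨le_rfl, by positivity⟩) hν

/-- ★★ **Every `SU(N)`, `N ≥ 3`, `d = 4`: `u'(0⁺) = 1/(2N)` in the tree coupling** (`u = ⟨W_p⟩`, `W = (1/N) Re tr`;
`Var_{Haar}(W_p) = 1/(2N²)` for `N ≥ 3`, times the factor `N` of the fluctuation–response formula): the leading strong-coupling
coefficient of the `SU(N)` mean plaquette as a kernel right-derivative at `b = 0` within `[0, N·9/308]`. -/
theorem hasDerivWithinAt_plaquette_zero_SU {N : ℕ} (hN : 3 ≤ N)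
    {μ : ℝ → Measure (LGConfig 4 (Matrix.specialUnitaryGroup (Fin N) ℂ))}
    (hμ : ∀ b ∈ Icc (0 : ℝ) ((N : ℝ) * (9 / 308)), μ b ∈ ymGibbsMeasures (d := 4) (fundamentalRep (Fin N)) b)
    (p : ZdPlaquette 4) :
    HasDerivWithinAt (fun t => ∫ U, zdPlaquetteObs (fundamentalRep (Fin N)) p.1 p.2.1.1 p.2.1.2 U ∂(μ t))
      (1 / (2 * N) : ℝ) (Icc (0 : ℝ) ((N : ℝ) * (9 / 308))) 0 := by
  haveI := secondCountable_suN' (N := N)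
  have hN0 : (0 : ℝ) < N := by exact_mod_cast (show 0 < N by omega)
  have h0 : μ 0 ∈ ymGibbsMeasures (d := 4) (fundamentalRep (Fin N)) 0 := hμ 0 ⟨le_rfl, by positivity⟩
  have h := hasDerivWithinAt_integral_SU_thooft (by omega) hμ (isLipschitzCylinder_zdPlaquetteObs (N := N) p.1 p.2.2)
    (x₀ := p.1) (D := 1) (fun e he => by simpa using norm_fst_sub_le_of_mem_plaquetteEdges he)
    (b := 0) ⟨le_rfl, by positivity⟩
  rw [eq_zdHaar_of_mem_zero_SU (by omega) h0,
    tsum_cov_zdPlaquetteObs_zdHaar (isSpecialUnitaryModel_fundamentalRep N) (by omega), charVariance_suN hN] at h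
  refine h.congr_deriv ?_
  field_simp

end ZeroCoupling

end Summit.Ventures.YMGap.PressureRegularity

end
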